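import Summits.HodgeConjecture.CorCM.DecicWeil23PairCyclicHodgeOfMarkman
import Literature.AlgebraicGeometry.Motives.ZarhinHodgeGroupAutC
import HarnessLib

/-!
# COR-CM — ONE CM abelian fivefold of `k`-signature `(2,3)` over ANY decic CM field `K ⊇ i(k)`: the Hodge conjecture for every
# `E^a × B^n`, GIVEN ONLY Markman's hyperbolic-sixfold theorem — NO Galois hypothesis

Cell `pub-hodgecm2` (COR-CM), seat b30 gen 23 (2026-08-22); count-neutral own lane DECIC-2T, part 3 («DECIC-C5-ANY», unconditional
form).  Theorems only; no definition, no named fact, no `sorry`.  HONEST FRAMING: CONDITIONAL on the single displayed named fact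
`HodgeTheory.Markman2025_weilClasses_algebraic_hyperbolicSixfold` (E. Markman, arXiv:2502.03415 Thm 1.5.1 — UNREFEREED); `HC_CM`
is not asserted and no case of the Hodge conjecture is claimed unconditionally.

WHAT IS NEW.  `CorCM/DecicWeil23PairCyclicHodgeOfMarkman` proved HC(`E^a × B^n`) from ONE automorphism of `ℂ` permuting the five
embeddings of `K` over `τ` cyclically (`hC5`).  That hypothesis is DISCHARGED here for every decic CM field: `Aut(ℂ)` acts
transitively on the embeddings of the countable field `K` (tree theorem `ZarhinLie.exists_ringEquiv_complex_comp_eq`), and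
fixing `τ` comes for free on the fibre; so the realised permutations of the five conjugate pairs form a TRANSITIVE group
(`realisedPerms_transitive`), whose order is divisible by `5` (orbit–stabiliser), whence an element of order `5` (Cauchy,
`exists_orderFive_mem_realisedPerms`), which in `Sym(5)` is a conjugate `g ρ₀ g⁻¹` of the standard rotation (`decide`,
`exists_conj_rot_of_orderFive`) — exactly the input of the cyclic frame theorem.
* **`hodgeConjectureFor_biproduct_comp_vec₂_of_markmanD_anyField (hM6 h10 h2 i hB hE hτΨ h23) (κ : Fin N → Fin 2)`** — `K ⊇ i(k)`
  ANY CM field of degree `10` over the imaginary quadratic `k`, `B ⊨ (K; Φ)` ANY CM abelian fivefold with two members of `Φ` over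
  `τ` (`k`-signature `(2,3)`), `E ⊨ (k; Ψ ∋ τ)`: the Hodge conjecture for every `⨁_j ![E, B](κ j)` = every `E^a × B^n`; with the
  `AVDominatedBy` form and the family form (every finite family of realisations of ONE `(2,3)`-type, `× E^a`, everything dominated).
[cite: Markman2025SecantWeil, Thm 1.5.1] [cite: Pohlmann1968, Thm 1] [cite: Shimura1998, §6.2 Thm. 3 and §18.2 Lemma (i)]
[cite: DixonMortimer1996, §2.1] [cite: MumfordAV1970, §19]

## References
* [Markman2025SecantWeil] E. Markman, arXiv:2502.03415 (unrefereed), Thm 1.5.1.  [Pohlmann1968] H. Pohlmann, Ann. of Math. 88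
  (1968), Thm 1.  [Shimura1998] G. Shimura, *Abelian varieties with CM and modular functions*, §6.2 Thm. 3, §18.2 Lemma (i).
  [DixonMortimer1996] J. D. Dixon, B. Mortimer, *Permutation Groups*, GTM 163 (1996), §2.1 (orbit–stabiliser; Cauchy).
  [MumfordAV1970] D. Mumford, *Abelian Varieties*, §19.
-/

noncomputable section

open CategoryTheory CategoryTheory.Limits NumberField

namespace Summit.HodgeConjecture.CorCM.DecicWeil23Pair

open Literature.AlgebraicGeometry Literature.AlgebraicGeometry.Motives Literature.AlgebraicGeometry.HodgeTheory
open Literature.AlgebraicGeometry.ComplexMultiplication (IsCMTypeRealisation)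
open Literature.AlgebraicTopology.SingularHomology
open Summit.HodgeConjecture.CorCM.Census.DecicWeil23Pair (dihPerm)
open Summit.HodgeConjecture.CorCM.Domination (AVDominatedBy)
open Summit.HodgeConjecture.CorCM.AndreRiemann (sumFam avDominatedBy_prod_of_biproduct avDominatedBy_biproduct_reindex)

open scoped Classical

/-! ## §1 The realised permutations are transitive; an element of order five; it is a conjugate rotation -/

section Realised

variable {K k : Type} [Field K] [NumberField K] [Field k] {e : (K →+* ℂ) ≃ Fin 5 × Bool} {i : k →+* K} {τ : k →+* ℂ}

/-- **`Aut(ℂ)` is transitive on the five embeddings over `τ`**: for any two labels some realised permutation maps one to the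
other (an automorphism of `ℂ` carrying one embedding of the countable field `K` to another exists by
`ZarhinLie.exists_ringEquiv_complex_comp_eq`; it fixes `τ` because both embeddings extend `τ`). [cite: Shimura1998, §18.2 Lemma (i)] -/
theorem exists_mem_realisedPerms_apply_eq (he_sign : ∀ s, (e s).2 = true ↔ s.comp i = τ) (a b : Fin 5) :
    ∃ π ∈ realisedPerms e, π a = b := by
  haveI : Countable K := Countable.of_equiv _ (Module.finBasis ℚ K).equivFun.toEquiv.symm
  obtain ⟨ρ, hρ⟩ := ZarhinLie.exists_ringEquiv_complex_comp_eq (e.symm (a, true)) (e.symm (b, true))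
  have hρa : (ρ : ℂ →+* ℂ).comp (e.symm (a, true)) = e.symm (b, true) := RingHom.ext fun z => hρ z
  have ha : (e.symm (a, true)).comp i = τ := (he_sign _).1 (by rw [Equiv.apply_symm_apply])
  have hb : (e.symm (b, true)).comp i = τ := (he_sign _).1 (by rw [Equiv.apply_symm_apply])
  have hρτ : (ρ : ℂ →+* ℂ).comp τ = τ := by
    calc (ρ : ℂ →+* ℂ).comp τ = ((ρ : ℂ →+* ℂ).comp (e.symm (a, true))).comp i := by rw [RingHom.comp_assoc, ha]
      _ = τ := by rw [hρa, hb]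
  obtain ⟨π, hπ⟩ := exists_perm_of_comp_tau_eq₅ he_sign ρ hρτ
  exact ⟨π, (mem_realisedPerms e π).2 ⟨ρ, hπ⟩, (Prod.mk.inj (e.symm.injective ((hπ a).symm.trans hρa))).1⟩

/-- **A realised permutation of order five** (the realised permutations form a transitive subgroup of `Sym(5)`: its order is
divisible by `5` by orbit–stabiliser, and Cauchy's theorem applies). [cite: DixonMortimer1996, §2.1] -/
theorem exists_orderFive_mem_realisedPerms (he_sign : ∀ s, (e s).2 = true ↔ s.comp i = τ) :
    ∃ σ ∈ realisedPerms e, σ ^ 5 = 1 ∧ σ ≠ 1 := by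
  let H : Subgroup (Equiv.Perm (Fin 5)) :=
    { carrier := {π | π ∈ realisedPerms e}
      mul_mem' := fun {π₁ π₂} h₁ h₂ => mul_mem_realisedPerms e π₁ h₁ π₂ h₂
      one_mem' := one_mem_realisedPerms e
      inv_mem' := fun {π} h => inv_mem_realisedPerms e π h }
  haveI : MulAction.IsPretransitive H (Fin 5) := ⟨fun a b => by
    obtain ⟨π, hπ, hab⟩ := exists_mem_realisedPerms_apply_eq he_sign a b
    exact ⟨⟨π, hπ⟩, hab⟩⟩
  have hidx : (MulAction.stabilizer H (0 : Fin 5)).index = 5 := by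
    rw [MulAction.index_stabilizer_of_transitive, Nat.card_eq_fintype_card, Fintype.card_fin]
  have hmul := (MulAction.stabilizer H (0 : Fin 5)).index_mul_card
  have hdvd : 5 ∣ Nat.card H :=
    ⟨Nat.card (MulAction.stabilizer H (0 : Fin 5)), by rw [← hmul, hidx]⟩
  haveI : Fact (Nat.Prime 5) := ⟨Nat.prime_five⟩
  obtain ⟨σ, hσ⟩ := exists_prime_orderOf_dvd_card' 5 hdvd
  refine ⟨σ.1, σ.2, ?_, fun h1 => ?_⟩
  · have h := pow_orderOf_eq_one σ
    rw [hσ] at h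
    have h' := congrArg Subtype.val h
    simpa using h'
  · have hσ1 : σ = 1 := Subtype.ext h1
    rw [hσ1, orderOf_one] at hσ
    exact absurd hσ (by norm_num)

/-- **An element of order five of `Sym(5)` is a conjugate of the standard rotation `ρ₀ = dihPerm 0 1`.** [folklore] -/
theorem exists_conj_rot_of_orderFive : ∀ σ : Equiv.Perm (Fin 5), σ ^ 5 = 1 → σ ≠ 1 →
    ∃ g : Equiv.Perm (Fin 5), g * dihPerm 0 1 * g⁻¹ = σ := by
  decide +kernel

/-- **Hence, over EVERY decic CM field, a conjugate of the rotation of the pairs is realised.** [cite: Shimura1998, §18.2 Lemma (i)] -/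
theorem exists_conj_rot_mem_realisedPerms (he_sign : ∀ s, (e s).2 = true ↔ s.comp i = τ) :
    ∃ g : Equiv.Perm (Fin 5), g * dihPerm 0 1 * g⁻¹ ∈ realisedPerms e := by
  obtain ⟨σ, hσ, h5, h1⟩ := exists_orderFive_mem_realisedPerms he_sign
  obtain ⟨g, hg⟩ := exists_conj_rot_of_orderFive σ h5 h1
  exact ⟨g, hg ▸ hσ⟩

end Realised

/-! ## §2 The Hodge conjecture for `E^a × B^n` over ANY decic CM field -/

section Main

variable {K : Type} [Field K] [NumberField K] [IsCMField K] {k : Type} [Field k] [NumberField k] [IsCMField k] {N : ℕ}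
  {Φ : CMType K} {B : AbelianVariety ℂ} {ι : 𝓞 K →+* End B} {θ : K →+* Module.End ℂ (complexBetti B.X 1)}
  {Ψ : CMType k} {E : AbelianVariety ℂ} {ιE : 𝓞 k →+* End E} {θE : k →+* Module.End ℂ (complexBetti E.X 1)}

/-- **THE HODGE CONJECTURE FOR EVERY `E^a × B^n` — `B` ANY CM ABELIAN FIVEFOLD OF `k`-SIGNATURE `(2,3)` WITH CM BY ANY DECIC CM
FIELD `K ⊇ i(k)`, `E` THE CM CURVE OF `k` — GIVEN ONLY Markman's hyperbolic-sixfold theorem; no Galois hypothesis.**  Hypotheses: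
`[K:ℚ] = 10`, `[k:ℚ] = 2`, `i : k → K`, `B ⊨ (K; Φ)` with two members of `Φ` over `τ` (`h23`), `E ⊨ (k; Ψ ∋ τ)`.  Conclusion: for every
`κ : Fin N → Fin 2`, every rational `(q,q)`-class on `⨁_j ![E, B](κ j)` is algebraic.  (The realised `5`-cycle required by
`hodgeConjectureFor_biproduct_comp_vec₂_of_markmanD_cyclic` always exists: §1.) [cite: Markman2025SecantWeil, Thm 1.5.1]
[cite: Pohlmann1968, Thm 1] [cite: Shimura1998, §6.2 Thm. 3] [cite: MumfordAV1970, §19] -/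
theorem hodgeConjectureFor_biproduct_comp_vec₂_of_markmanD_anyField
    (hM6 : Markman2025_weilClasses_algebraic_hyperbolicSixfold)
    (h10 : Module.finrank ℚ K = 10) (h2 : Module.finrank ℚ k = 2) (i : k →+* K)
    (hB : IsCMTypeRealisation Φ B ι θ) (hE : IsCMTypeRealisation Ψ E ιE θE) {τ : k →+* ℂ} (hτΨ : τ ∈ Ψ.1)
    (h23 : (Finset.univ.filter fun s : K →+* ℂ => s.comp i = τ ∧ s ∈ Φ.1).card = 2) (κ : Fin N → Fin 2) :
    HodgeConjectureFor (⨁ fun j => (![E, B] : Fin 2 → AbelianVariety ℂ) (κ j)).dim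
      (⨁ fun j => (![E, B] : Fin 2 → AbelianVariety ℂ) (κ j)).X := by
  have hττ : ComplexEmbedding.conjugate τ ≠ τ := QuarticCM.conjugate_ne τ
  have hk : ∀ σ : k →+* ℂ, σ = τ ∨ σ = ComplexEmbedding.conjugate τ := fun σ =>
    QuarticCM.eq_or_eq_conjugate_of_quadratic h2 τ σ
  -- any frame of the fibre gives a realised `5`-cycle acting on an enumeration
  obtain ⟨e, he_sign, -⟩ := exists_frame₅ h10 h2 i hττ hk
  obtain ⟨g, hrot⟩ := exists_conj_rot_mem_realisedPerms he_sign
  obtain ⟨ρ, hρ⟩ := (mem_realisedPerms e _).1 hrot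
  have hover : ∀ a : Fin 5, (e.symm (a, true)).comp i = τ := fun a => (he_sign _).1 (by rw [Equiv.apply_symm_apply])
  -- the enumeration `x_l = e⁻¹(g l, true)` is rotated by `ρ`
  let x : Fin 5 ↪ {s : K →+* ℂ // s.comp i = τ} :=
    ⟨fun l => ⟨e.symm (g l, true), hover (g l)⟩, fun l l' h => g.injective
      (Prod.mk.inj (e.symm.injective (congrArg Subtype.val h))).1⟩
  have hx : ∀ l : Fin 5, (ρ : ℂ →+* ℂ).comp (x l).1 = (x (l + 1)).1 := fun l => by
    change (ρ : ℂ →+* ℂ).comp (e.symm (g l, true)) = e.symm (g (l + 1), true)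
    rw [hρ (g l), Equiv.Perm.mul_apply, Equiv.Perm.mul_apply, show g⁻¹ (g l) = l from g.symm_apply_apply l,
      dihPerm_zero_one_apply]
  exact hodgeConjectureFor_biproduct_comp_vec₂_of_markmanD_cyclic hM6 h10 h2 i hB hE hτΨ h23 ⟨x, ρ, hx⟩ κ

/-- **Everything dominated by a product of copies of `E, B`** (abelian subvarieties, quotients, isogenous varieties; e.g. every
power of every abelian variety isogenous to `E^a × B^n`) satisfies the Hodge conjecture, GIVEN ONLY Markman's sixfold theorem.
[cite: Markman2025SecantWeil, Thm 1.5.1] [cite: MumfordAV1970, §19] -/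
theorem hodgeConjectureFor_of_avDominatedBy_comp_vec₂_of_markmanD_anyField
    (hM6 : Markman2025_weilClasses_algebraic_hyperbolicSixfold)
    (h10 : Module.finrank ℚ K = 10) (h2 : Module.finrank ℚ k = 2) (i : k →+* K)
    (hB : IsCMTypeRealisation Φ B ι θ) (hE : IsCMTypeRealisation Ψ E ιE θE) {τ : k →+* ℂ} (hτΨ : τ ∈ Ψ.1)
    (h23 : (Finset.univ.filter fun s : K →+* ℂ => s.comp i = τ ∧ s ∈ Φ.1).card = 2) (κ : Fin N → Fin 2)
    {C : AbelianVariety ℂ} (hC : AVDominatedBy C (⨁ fun j => (![E, B] : Fin 2 → AbelianVariety ℂ) (κ j))) :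
    HodgeConjectureFor C.dim C.X :=
  Domination.hodgeConjectureFor_of_avDominatedBy
    (hodgeConjectureFor_biproduct_comp_vec₂_of_markmanD_anyField hM6 h10 h2 i hB hE hτΨ h23 κ) hC

end Main

/-! ## §3 The family form: all realisations of one `(2,3)`-type -/

section Family

variable {K : Type} [Field K] [NumberField K] [IsCMField K] {k : Type} [Field k] [NumberField k] [IsCMField k]
  {n : ℕ} {Φ : Fin n → CMType K} {A : Fin n → AbelianVariety ℂ} {ι : ∀ j, 𝓞 K →+* End (A j)}
  {θ : ∀ j, K →+* Module.End ℂ (complexBetti (A j).X 1)}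
  {Ψ : CMType k} {E : AbelianVariety ℂ} {ιE : 𝓞 k →+* End E} {θE : k →+* Module.End ℂ (complexBetti E.X 1)}

/-- **THE FAMILY FORM over ANY decic CM field.**  `A_j ⊨ (K; Φ_j)` (`j < n`) CM abelian fivefolds all of the SAME `(2,3)`-type
`Φ_{j₁}` (e.g. a CM fivefold and its Galois conjugates of the same type, with any CM structures), `E ⊨ (k; Ψ ∋ τ)`: every `C`
dominated by `E^a × ⨁_j A_j` satisfies the Hodge conjecture, GIVEN ONLY Markman's sixfold theorem.
[cite: Markman2025SecantWeil, Thm 1.5.1] [cite: Shimura1998, §6.1 Thm. 2 Cor.] [cite: MumfordAV1970, §19] -/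
theorem hodgeConjectureFor_of_avDominatedBy_family₁_of_markmanD_anyField
    (hM6 : Markman2025_weilClasses_algebraic_hyperbolicSixfold)
    (h10 : Module.finrank ℚ K = 10) (h2 : Module.finrank ℚ k = 2) (i : k →+* K)
    (hA : ∀ j, IsCMTypeRealisation (Φ j) (A j) (ι j) (θ j)) {τ : k →+* ℂ} (j₁ : Fin n)
    (h23 : (Finset.univ.filter fun s : K →+* ℂ => s.comp i = τ ∧ s ∈ (Φ j₁).1).card = 2) (hpos : ∀ j, Φ j = Φ j₁)
    (hE : IsCMTypeRealisation Ψ E ιE θE) (hτΨ : τ ∈ Ψ.1) (a : ℕ)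
    {C : AbelianVariety ℂ} (hC : AVDominatedBy C ((⨁ fun _ : Fin a => E).prod (⨁ A))) :
    HodgeConjectureFor C.dim C.X := by
  have hdomB : ∀ j, AVDominatedBy (A j) (A j₁) := fun j => avDominatedBy_of_cmType_eq (hpos j) (hA j) (hA j₁)
  let Y : Fin 2 → AbelianVariety ℂ := ![E, A j₁]
  have h₁ : AVDominatedBy (⨁ fun _ : Fin a => E) (⨁ fun _ : Fin a => Y 0) :=
    AVDominatedBy.biproduct_map fun _ => AVDominatedBy.refl E
  have h₂ : AVDominatedBy (⨁ A) (⨁ fun _ : Fin n => Y 1) :=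
    AVDominatedBy.biproduct_map fun j => hdomB j
  have h₁₂' := avDominatedBy_prod_of_biproduct h₁ h₂
  let κ' : Fin a ⊕ Fin n → Fin 2 := Sum.elim (fun _ => 0) fun _ => 1
  have hfam : sumFam (fun _ : Fin a => Y 0) (fun _ : Fin n => Y 1) = Y ∘ κ' := funext fun x => by
    cases x <;> rfl
  rw [hfam] at h₁₂'
  have hdom := avDominatedBy_biproduct_reindex finSumFinEquiv.symm h₁₂'
  exact Domination.hodgeConjectureFor_of_avDominatedBy
    (hodgeConjectureFor_biproduct_comp_vec₂_of_markmanD_anyField hM6 h10 h2 i (hA j₁) hE hτΨ h23 (κ' ∘ finSumFinEquiv.symm))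
    (hC.trans hdom)

/-- **In particular: the Hodge conjecture for `∏_j A_j` itself** — every product of members of ONE `(2,3)`-isogeny class over
ANY decic CM field (e.g. `B^n`, or `B × B^σ` for a Galois conjugate of the same type), GIVEN ONLY Markman's sixfold theorem.
[cite: Markman2025SecantWeil, Thm 1.5.1] [cite: MumfordAV1970, §19] -/
theorem hodgeConjectureFor_biproduct_family₁_of_markmanD_anyField
    (hM6 : Markman2025_weilClasses_algebraic_hyperbolicSixfold)
    (h10 : Module.finrank ℚ K = 10) (h2 : Module.finrank ℚ k = 2) (i : k →+* K)
    (hA : ∀ j, IsCMTypeRealisation (Φ j) (A j) (ι j) (θ j)) {τ : k →+* ℂ} (j₁ : Fin n)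
    (h23 : (Finset.univ.filter fun s : K →+* ℂ => s.comp i = τ ∧ s ∈ (Φ j₁).1).card = 2) (hpos : ∀ j, Φ j = Φ j₁)
    (hE : IsCMTypeRealisation Ψ E ιE θE) (hτΨ : τ ∈ Ψ.1) :
    HodgeConjectureFor (⨁ A).dim (⨁ A).X :=
  hodgeConjectureFor_of_avDominatedBy_family₁_of_markmanD_anyField hM6 h10 h2 i hA j₁ h23 hpos hE hτΨ 0
    (C := ⨁ A) ⟨AbelianVariety.prodLift 0 (𝟙 _), AbelianVariety.snd _ _, 1, one_ne_zero, by
      rw [AbelianVariety.prodLift_snd, one_smul]⟩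

end Family

end Summit.HodgeConjecture.CorCM.DecicWeil23Pair

end
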